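import Summits.AtomisticToContinuum.Crystallization.Theorems.FrustratedLawDichotomyRangeCut

/-!
# FrustratedLawDichotomy · the energetic residual cut by range WITHOUT separation: the SCHUR (positive-definite) tail floor
# (decomp-a2c, lens-5 «finite/base range + asymptotic regime + bridge», generation 34 — RESIDUAL MODE, D-0179)

State of record (critic row 480, TREE v3.05): the column's energetic input is `FDG` (typed verbatim in
`FrustratedLawDichotomyRangeCut`, = the hypothesis of the door theorem `aperiodicFrustratedLawGap_of_frustrationDensityGap`), split as
`FDG ⟺ E′ ∧ T′` and range-cut over the ONE-BODY floor `TailFloor R A` (`−A·Σ min(nn_i,1)⁻³ ≤ Σ_{i<j} tailLJ R`).  ERRATUM of this generation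
(bus 2026-08-31T15:12Z): the generation-33 literal `T′_5` (`FiniteRangeTopologicalPricing (1/20)(1/8) 5 (1/96) (−0.7175) (1/200) C_T`) is
FALSE-type-indicated — a STRAINED cluster (every interior site `1/8`-good and `1/20`-bad, e.g. the hcp ball under a `3.66 %` basal shear,
excess `3.596·10⁻³` per site) is neutral on its left side and must finance the tail slack `ε_5 + (eUp − e⋆) = 7.0·10⁻³` alone; the honest
bite point of the one-body floor is `R = 7` (`ε_7 = 1.77·10⁻³`, ×2.0), `R = 6` marginal (×1.03).  The defect is in the FLOOR, not in the
shape of the cut.  This file replaces the floor.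

## The lever (new on this column; no separation, no density proxy, no Voronoi cells, no transport)

Split `V_LJ = V·(1−w) + V·w` with a SMOOTH tail weight `w` rising from `0` to `1` across `[R_a, R_b]` (`cutWeight`, smoothstep profiles
`smoothstep₁/₂`), so the tail part `ψ = V·w ≤ 0` is a smooth radial function.  Let `β = (1 − |x|²/a²)₊²` (a compactly supported bump),
`k₂ = β ∗ β` (support `2a`; radial profile `k₂(0)·omega₂(r/a)` with the EXACT polynomial `omega₂` below) and let `K ≥ 0` be an integrable
radial DOMINATOR with `(k₂ ∗ K)(z) ≥ |ψ(|z|)|` for all `z` (beyond `R_b + 2a` one may take `K = |V|` exactly, `|x|⁻⁶` being subharmonic;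
inside, `K` is a 1-D deconvolution certificate).  Then for EVERY finite configuration — no injectivity, no hard core —
  `Σ_{i<j} ψ(r_ij) ≥ −Σ_{i<j} (k₂∗K)(y_i − y_j) ≥ −½ ∫K(u) ⟨F, F(·−u)⟩ du ≥ −½‖K‖₁‖F‖₂² = −A·(N + 2·Σ_{i<j} ω(r_ij))`,
`F = Σ_i β(· − y_i)`, `ω = k₂/k₂(0)`, `A = ½‖K‖₁k₂(0)` (Tonelli + Cauchy–Schwarz: the SCHUR / Bochner positivity step).  The cross terms
that the one-body floor had to absorb into a density proxy are charged EXACTLY, as the compactly supported pair term `2A·ω(r_ij)`, so the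
effective potential `W = V·(1−w) − 2A·ω` is again FINITE-RANGE (`max(R_b, 2a)`) and `U ≥ Σ_{i<j} W(r_ij) − A·N` configuration-wise
(`le_interactionEnergy_of_schurFloor`).  `SchurFloor w ω A` states exactly this inequality; `SchurDomination` (§6, PROVED via hand-1 g12's tree theorem) is the abstract
principle behind it, typed for provers (KNOWN-type, Mathlib-sized).

## Pieces (Target `FDG`; tags per D-0171)

* `SchurFloor w ω A` (SF) — KNOWN-type analysis (Schur test) + a 1-D numerical domination certificate · strictly WEAKER than anything on the
  column (a statement about `V_LJ` alone, true for all point sets) · ATTACKABLE (`SchurDomination` is PROVED, §6; radialise, certify `k₂∗K ≥ |ψ|`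
  by interval arithmetic — or use the closed-form dominator of NODE-g34.md §4 at half the bite).
* `PeriodicEnergyCeiling eUp` (UP) — IN THE TREE at `eUp = −0.7175`.
* `SchurRangeGap w ω A e₁ C` (FRG♭, unsplit residual), `SchurTopologicalPricing …` (T′♭), `SchurElasticPricing …` (E′♭) — the residuals,
  now FINITE-RANGE functionals of range `R_b ∨ 2a` with a certified constant reference level; UNDECIDED · TRUE-type-indicated at the literal
  data below (every homogeneous competitor passes with margin ≥ ×2) · BARRIER TetrahedralFrustration (site-wise false: icosahedral centres sit
  below `e⋆`; only the SUM is claimed) · INSTRUMENTABLE (basin-hopping adversaries on `Σ W`, cheaper than on `U`).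
* kernels, all proved here: `FDG ⟸ SF ∧ UP ∧ FRG♭ ∧ (eUp < e₁)` (`fdg_of_schurCut`), `T′ ⟸ SF ∧ UP ∧ T′♭` (`topologicalPricing_of_schurCut`),
  `E′ ⟸ SF ∧ UP ∧ E′♭` (`elasticPricing_of_schurCut`), `FDG ⟸ SF ∧ UP ∧ T′♭ ∧ E′♭` (`fdg_of_split_schurCut`, BOTH halves finite-range — new),
  literal instances at ranges `4`, `9/2` and `5` (§4; the closed-form floors are `SF₄₅` and `SF₅`) and the crux BY NAME (§5, via
  `aperiodicFrustratedLawGap_of_fdg`).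

## MEASURED (HOME/decomp-a2c-lens-5/g34/scripts/{schurfloor,validate,omega_exact}.py, pure python, ≤ 2 core-min each; logs/)

Optimal-dominator slack per site `s = A·Σ_{j∈L}ω(r_j) − ½Σ_{j≠0}|ψ(r_j)|` at `fcc⋆/hcp⋆` (nn `0.97123`), Richardson–Lucy deconvolution on a
`0.02` grid, off-grid domination re-verified on a `0.005` grid, `‖K‖₁` safety ×1.003, `A` rounded UP to the rationals used below:
range `4` (`w`: smoothstep₁ over `[5/2, 4]`, `a = 4/5`, `A = 29/2500`, numerical dominator): `s = 1.68·10⁻³`; range `5` (`w`: smoothstep₂ over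
`[3, 5]`, `a = 1`): LP-optimal `s = 8.1·10⁻⁴` (`A = 19/6000`), CLOSED-FORM dominator `K = (r⁻⁶/6)·smoothstep₁((r − 18/5)/(2/5))` (the literal
`SF₅`, `A = 13/4000`): `s = 1.07·10⁻³`; range `9/2` (`w`: smoothstep₁ over `[3, 9/2]`, `a = 4/5`): LP `8.0·10⁻⁴`, CLOSED FORM
`K = (r⁻⁶/6)·smoothstep₁((r − 33/10)/(3/5))` (the literal `SF₄₅`, `A = 3/400`): `s = 1.15·10⁻³`; (`5.5`: `4.2·10⁻⁴`, `6`: `2.8·10⁻⁴`, LP;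
`≤ 3.5`: no bite, best `3.4·10⁻³`).
One-body floor of generation 33 for comparison: `ε_5 = 6.95·10⁻³`, `ε_6 = 3.40·10⁻³`, `ε_7 = 1.77·10⁻³` — the Schur floor buys ≈ 3 units of range.
TRUE-type tests (strain ceilings of generation 33: tight `κ_el(1/20) = 3.596·10⁻³` = hcp basal shear `3.66 %`; loose `1/8`: `1.627·10⁻²`;
`eUp − e⋆ = 9.0·10⁻⁵`): STRAINED adversary must satisfy `s + (eUp − e⋆) ≤ 3.596·10⁻³`: range 4 ×2.08, range 5 (literal `SF₅`) ×3.29 (generation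
33 needed `R = 7` for ×2.0; critic row 484 (c) criterion `s ≤ 1.75·10⁻³`: `1.64·10⁻³` / `1.07·10⁻³`, both PASS); FRG♭ at `e₁ = −0.7174`: ×1.97 /
×2.86; T′♭ at `κ_T = 1/100`: room `1.45·10⁻²` / `1.51·10⁻²`; E′♭ at `κ_E = 1/1000`: room `1.87·10⁻³` / `2.44·10⁻³`.  The floor inequality itself was checked directly on hcp balls (`N = 1099`; perfect, sheared, jiggled `σ = 0.08`,
compressed ×0.8, dilated ×1.3), random gases (`600`, `900` points in `7³`) and two touching balls: total slack `+2.7 … +26.8`, never negative.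
All statements below are `[folklore]` bookkeeping; no new analysis is claimed proved here.
-/

noncomputable section

namespace Summit.AtomisticToContinuum.Crystallization.Theorems.FrustratedLawDichotomySchurCut

open scoped BigOperators
open MeasureTheory
open Literature.MathematicalPhysics.StatisticalMechanics (interactionEnergy lennardJones PeriodicConfiguration)
open Summit.AtomisticToContinuum.Crystallization.Theorems.ChargedEnergyGapNegative (E3 eStar eStar_le)
open Summit.AtomisticToContinuum.Crystallization.Theorems.FrustratedLawDichotomyRangeCut

/-! ## §1. Smooth range splitting of the potential -/

/-- Cubic smoothstep `3x² − 2x³`, clipped to `[0,1]` (a `C¹` profile). -/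
def smoothstep₁ (x : ℝ) : ℝ := if x ≤ 0 then 0 else if 1 ≤ x then 1 else 3 * x ^ 2 - 2 * x ^ 3

/-- Quintic smoothstep `10x³ − 15x⁴ + 6x⁵`, clipped to `[0,1]` (a `C²` profile). -/
def smoothstep₂ (x : ℝ) : ℝ := if x ≤ 0 then 0 else if 1 ≤ x then 1 else 10 * x ^ 3 - 15 * x ^ 4 + 6 * x ^ 5

/-- **Smooth tail weight** across the window `[Ra, Rb]` with profile `S`: `w(r) = S((r − Ra)/(Rb − Ra))` (`0` below `Ra`, `1` above `Rb`). -/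
def cutWeight (S : ℝ → ℝ) (Ra Rb r : ℝ) : ℝ := S ((r - Ra) / (Rb - Ra))

/-- **Core part** `V·(1 − w)` of the Lennard-Jones potential under the tail weight `w` (finite range `Rb` when `w = 1` beyond `Rb`). -/
def corePot (w : ℝ → ℝ) (r : ℝ) : ℝ := lennardJones r * (1 - w r)

/-- **Tail part** `ψ = V·w` (smooth, `≤ 0` once `w` vanishes below `2^{-1/6}`). -/
def tailPot (w : ℝ → ℝ) (r : ℝ) : ℝ := lennardJones r * w r

/-- `V = corePot w + tailPot w` pointwise. [folklore] -/
theorem corePot_add_tailPot (w : ℝ → ℝ) (r : ℝ) : corePot w r + tailPot w r = lennardJones r := by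
  unfold corePot tailPot; ring

/-- Homogeneity of the interaction energy in the potential. [folklore] -/
theorem interactionEnergy_smul {N : ℕ} (c : ℝ) (V : ℝ → ℝ) (y : Fin N → EuclideanSpace ℝ (Fin 3)) :
    interactionEnergy (fun r => c * V r) y = c * interactionEnergy V y := by
  simp only [interactionEnergy, Finset.mul_sum]

/-- Subtractivity of the interaction energy in the potential. [folklore] -/
theorem interactionEnergy_sub {N : ℕ} (V W : ℝ → ℝ) (y : Fin N → EuclideanSpace ℝ (Fin 3)) :
    interactionEnergy (fun r => V r - W r) y = interactionEnergy V y - interactionEnergy W y := by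
  simp only [interactionEnergy, Finset.sum_sub_distrib]

/-- **SMOOTH RANGE SPLIT of the cluster energy**: `U = Σ corePot w + Σ tailPot w`. [folklore] -/
theorem interactionEnergy_core_add_tail (w : ℝ → ℝ) {N : ℕ} (y : Fin N → EuclideanSpace ℝ (Fin 3)) :
    interactionEnergy lennardJones y = interactionEnergy (corePot w) y + interactionEnergy (tailPot w) y := by
  rw [← interactionEnergy_add]
  congr 1
  funext r
  exact (corePot_add_tailPot w r).symm

/-! ## §2. The Schur tail floor and the effective finite-range potential -/

/-- **`omega₂` — the exact radial profile of `β ∗ β / (β ∗ β)(0)` for the bump `β = (1 − |x|²)₊²` in `ℝ³`** (support `[0,2)`, value `1` at `0`;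
odd powers from the sphere-intersection kinematics; computed in exact rational arithmetic, `scripts/omega_exact.py`). -/
def omega₂ (x : ℝ) : ℝ :=
  if x < 2 then 1 - 11 / 6 * x ^ 2 + 33 / 16 * x ^ 4 - 77 / 64 * x ^ 5 + 33 / 256 * x ^ 7 - 11 / 1024 * x ^ 9 + 5 / 12288 * x ^ 11 else 0

/-- `omega₂ 0 = 1`. [folklore] -/
theorem omega₂_zero : omega₂ 0 = 1 := by norm_num [omega₂]

/-- `omega₂` vanishes from `2` on. [folklore] -/
theorem omega₂_of_two_le {x : ℝ} (h : 2 ≤ x) : omega₂ x = 0 := by simp [omega₂, not_lt.mpr h]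

/-- **SF — the SCHUR TAIL FLOOR** with tail weight `w`, overlap kernel `ω` and constant `A` (piece · KNOWN-type + 1-D certificate · ATTACKABLE):
for EVERY finite configuration (no injectivity, no separation) `−A·(N + 2·Σ_{i<j} ω(r_ij)) ≤ Σ_{i<j} (V·w)(r_ij)`.
The instance behind it: `ω = (β∗β)/(β∗β)(0)`, `A = ½‖K‖₁(β∗β)(0)` for a dominator `K ≥ 0`, `(β∗β∗K) ≥ |V·w|` (§6 `SchurDomination`). -/
def SchurFloor (w ω : ℝ → ℝ) (A : ℝ) : Prop :=
  ∀ (N : ℕ) (y : Fin N → EuclideanSpace ℝ (Fin 3)),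
    -(A * N + 2 * A * interactionEnergy ω y) ≤ interactionEnergy (tailPot w) y

/-- **W — the effective FINITE-RANGE potential** `W = V·(1 − w) − 2A·ω` (range `Rb ∨ supp ω`). -/
def effPot (w ω : ℝ → ℝ) (A : ℝ) (r : ℝ) : ℝ := corePot w r - 2 * A * ω r

/-- `Σ W = Σ corePot w − 2A·Σ ω`. [folklore] -/
theorem interactionEnergy_effPot (w ω : ℝ → ℝ) (A : ℝ) {N : ℕ} (y : Fin N → EuclideanSpace ℝ (Fin 3)) :
    interactionEnergy (effPot w ω A) y = interactionEnergy (corePot w) y - 2 * A * interactionEnergy ω y := by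
  have h := interactionEnergy_sub (corePot w) (fun r => 2 * A * ω r) y
  rw [interactionEnergy_smul] at h
  exact h

/-- **KERNEL 0 — the floor makes `U` a finite-range functional up to `A` per particle**: `SF ⟹ Σ_{i<j} W(r_ij) − A·N ≤ U(y)` for every `y`.
[folklore] -/
theorem le_interactionEnergy_of_schurFloor {w ω : ℝ → ℝ} {A : ℝ} (h : SchurFloor w ω A) {N : ℕ}
    (y : Fin N → EuclideanSpace ℝ (Fin 3)) :
    interactionEnergy (effPot w ω A) y - A * N ≤ interactionEnergy lennardJones y := by
  have h1 := h N y
  rw [interactionEnergy_effPot, interactionEnergy_core_add_tail w y]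
  linarith

/-! ## §3. The finite-range residuals over the Schur floor -/

/-- **FRG♭ — SCHUR-CUT FRUSTRATION GAP** (residual of the UNSPLIT cut · UNDECIDED, TRUE-type-indicated at the §5 data · BARRIER
TetrahedralFrustration, site-wise false — only the sum is claimed · finite range): over `7/10`-separated clusters the finite-range energy
`Σ W − A·N` lies above the literal level `e₁·N` up to `C` per tightly-good site.  TRUE-type needs `s + (e₁ − e⋆) ≤ 3.596·10⁻³` (MEASURED). -/
def SchurRangeGap (w ω : ℝ → ℝ) (A e₁ C : ℝ) : Prop :=
  ∀ (N : ℕ) (y : Fin N → EuclideanSpace ℝ (Fin 3)), Function.Injective y → Sep y →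
    e₁ * N - C * (goodCount (1 / 20) y : ℝ) ≤ interactionEnergy (effPot w ω A) y - A * N

/-- **T′♭ — SCHUR-CUT TOPOLOGICAL PRICING** at tolerances `η₀ < η₁` (residual beneath T′ · UNDECIDED, TRUE-type-indicated at `κ_T = 1/100`,
`η₁ = 1/8`, ranges 4 and 5 · BARRIER TetrahedralFrustration · finite range): `eUp·N + κ_T·(N − ℓ) − C_T·g ≤ Σ W − A·N`. -/
def SchurTopologicalPricing (η₀ η₁ : ℝ) (w ω : ℝ → ℝ) (A eUp κT CT : ℝ) : Prop :=
  ∀ (N : ℕ) (y : Fin N → EuclideanSpace ℝ (Fin 3)), Function.Injective y → Sep y →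
    eUp * N + κT * ((N : ℝ) - goodCount η₁ y) - CT * goodCount η₀ y ≤ interactionEnergy (effPot w ω A) y - A * N

/-- **E′♭ — SCHUR-CUT ELASTIC PRICING** (residual beneath E′, the near-crystal regime · UNDECIDED, TRUE-type-indicated at `κ_E = 1/1000` ·
ATTACKABLE-L: geometric rigidity + Cauchy–Born on a FINITE-RANGE functional with a constant reference level): 
`eUp·N + κ_E·(ℓ − g) − C_E·g − D_E·(N − ℓ) ≤ Σ W − A·N`. -/
def SchurElasticPricing (η₀ η₁ : ℝ) (w ω : ℝ → ℝ) (A eUp κE CE DE : ℝ) : Prop :=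
  ∀ (N : ℕ) (y : Fin N → EuclideanSpace ℝ (Fin 3)), Function.Injective y → Sep y →
    eUp * N + κE * ((goodCount η₁ y : ℝ) - goodCount η₀ y) - CE * goodCount η₀ y - DE * ((N : ℝ) - goodCount η₁ y) ≤
      interactionEnergy (effPot w ω A) y - A * N

/-- **KERNEL of the unsplit Schur cut, `e⋆`-form**: `SF ∧ (e⋆ ≤ eUp) ∧ FRG♭(e₁, C) ∧ (eUp < e₁) ⟹ FDG` (`κ = e₁ − eUp`). [folklore] -/
theorem fdg_of_schurCut' {w ω : ℝ → ℝ} {A eUp e₁ C : ℝ} (hF : SchurFloor w ω A) (hst : eStar ≤ eUp)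
    (hG : SchurRangeGap w ω A e₁ C) (he : eUp < e₁) : FDG := by
  rw [fdg_iff]
  refine ⟨e₁ - eUp, sub_pos.mpr he, C, fun N y hy hsep => ?_⟩
  have h1 := le_interactionEnergy_of_schurFloor hF y
  have h2 := hG N y hy hsep
  have hN : (N : ℝ) * eStar ≤ N * eUp := mul_le_mul_of_nonneg_left hst (Nat.cast_nonneg N)
  linarith

/-- **KERNEL of the unsplit Schur cut**: `SF ∧ UP(eUp) ∧ FRG♭(e₁, C) ∧ (eUp < e₁) ⟹ FDG`. [folklore] -/
theorem fdg_of_schurCut {w ω : ℝ → ℝ} {A eUp e₁ C : ℝ} (hF : SchurFloor w ω A) (hU : PeriodicEnergyCeiling eUp)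
    (hG : SchurRangeGap w ω A e₁ C) (he : eUp < e₁) : FDG :=
  fdg_of_schurCut' hF (eStar_le_of_periodicEnergyCeiling hU) hG he

/-- **KERNEL beneath T′, `e⋆`-form**: `SF ∧ (e⋆ ≤ eUp) ∧ T′♭(κ_T > 0, C_T) ⟹ T′` (same constants). [folklore] -/
theorem topologicalPricing_of_schurCut' {η₀ η₁ : ℝ} {w ω : ℝ → ℝ} {A eUp κT CT : ℝ} (hF : SchurFloor w ω A) (hst : eStar ≤ eUp)
    (hκ : 0 < κT) (hT : SchurTopologicalPricing η₀ η₁ w ω A eUp κT CT) : TopologicalPricing η₀ η₁ := by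
  refine ⟨κT, hκ, CT, fun N y hy hsep => ?_⟩
  have h1 := le_interactionEnergy_of_schurFloor hF y
  have h2 := hT N y hy hsep
  have hN : (N : ℝ) * eStar ≤ N * eUp := mul_le_mul_of_nonneg_left hst (Nat.cast_nonneg N)
  linarith

/-- **KERNEL beneath T′**: `SF ∧ UP(eUp) ∧ T′♭ ⟹ T′`. [folklore] -/
theorem topologicalPricing_of_schurCut {η₀ η₁ : ℝ} {w ω : ℝ → ℝ} {A eUp κT CT : ℝ} (hF : SchurFloor w ω A)
    (hU : PeriodicEnergyCeiling eUp) (hκ : 0 < κT) (hT : SchurTopologicalPricing η₀ η₁ w ω A eUp κT CT) :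
    TopologicalPricing η₀ η₁ :=
  topologicalPricing_of_schurCut' hF (eStar_le_of_periodicEnergyCeiling hU) hκ hT

/-- **KERNEL beneath E′, `e⋆`-form**: `SF ∧ (e⋆ ≤ eUp) ∧ E′♭(κ_E > 0, C_E, D_E) ⟹ E′` (same constants). [folklore] -/
theorem elasticPricing_of_schurCut' {η₀ η₁ : ℝ} {w ω : ℝ → ℝ} {A eUp κE CE DE : ℝ} (hF : SchurFloor w ω A) (hst : eStar ≤ eUp)
    (hκ : 0 < κE) (hE : SchurElasticPricing η₀ η₁ w ω A eUp κE CE DE) : ElasticPricing η₀ η₁ := by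
  refine ⟨κE, hκ, CE, DE, fun N y hy hsep => ?_⟩
  have h1 := le_interactionEnergy_of_schurFloor hF y
  have h2 := hE N y hy hsep
  have hN : (N : ℝ) * eStar ≤ N * eUp := mul_le_mul_of_nonneg_left hst (Nat.cast_nonneg N)
  linarith

/-- **KERNEL beneath E′**: `SF ∧ UP(eUp) ∧ E′♭ ⟹ E′`. [folklore] -/
theorem elasticPricing_of_schurCut {η₀ η₁ : ℝ} {w ω : ℝ → ℝ} {A eUp κE CE DE : ℝ} (hF : SchurFloor w ω A)
    (hU : PeriodicEnergyCeiling eUp) (hκ : 0 < κE) (hE : SchurElasticPricing η₀ η₁ w ω A eUp κE CE DE) :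
    ElasticPricing η₀ η₁ :=
  elasticPricing_of_schurCut' hF (eStar_le_of_periodicEnergyCeiling hU) hκ hE

/-- **KERNEL of the FULLY FINITE-RANGE split**: `SF ∧ UP ∧ T′♭(1/20, η₁) ∧ E′♭(1/20, η₁) ⟹ FDG` (`η₁ ≥ 1/20`; both halves are statements
about the range-`Rb ∨ 2a` functional `Σ W`). [folklore] -/
theorem fdg_of_split_schurCut {η₁ : ℝ} {w ω : ℝ → ℝ} {A eUp κT CT κE CE DE : ℝ} (h01 : (1 : ℝ) / 20 ≤ η₁)
    (hF : SchurFloor w ω A) (hU : PeriodicEnergyCeiling eUp)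
    (hκT : 0 < κT) (hT : SchurTopologicalPricing (1 / 20) η₁ w ω A eUp κT CT)
    (hκE : 0 < κE) (hE : SchurElasticPricing (1 / 20) η₁ w ω A eUp κE CE DE) : FDG :=
  fdg_of_elastic_of_topological h01 (elasticPricing_of_schurCut hF hU hκE hE) (topologicalPricing_of_schurCut hF hU hκT hT)

/-- **KERNEL of the MIXED split** (E′ kept infinite-range as in generation 33, T′ Schur-cut): `E′ ∧ SF ∧ UP ∧ T′♭ ⟹ FDG`. [folklore] -/
theorem fdg_of_elastic_of_schurCut {η₁ : ℝ} {w ω : ℝ → ℝ} {A eUp κT CT : ℝ} (h01 : (1 : ℝ) / 20 ≤ η₁)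
    (hE : ElasticPricing (1 / 20) η₁) (hF : SchurFloor w ω A) (hU : PeriodicEnergyCeiling eUp)
    (hκT : 0 < κT) (hT : SchurTopologicalPricing (1 / 20) η₁ w ω A eUp κT CT) : FDG :=
  fdg_of_elastic_of_topological h01 hE (topologicalPricing_of_schurCut hF hU hκT hT)

/-- The residuals are monotone in their constants: FRG♭ survives lowering the level and raising the allowance. [folklore] -/
theorem schurRangeGap_mono {w ω : ℝ → ℝ} {A e₁ e₁' C C' : ℝ} (h : SchurRangeGap w ω A e₁ C) (he : e₁' ≤ e₁) (hC : C ≤ C') :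
    SchurRangeGap w ω A e₁' C' := fun N y hy hsep => by
  have h1 := h N y hy hsep
  have hg0 : (0 : ℝ) ≤ goodCount (1 / 20) y := Nat.cast_nonneg _
  have e1 : e₁' * (N : ℝ) ≤ e₁ * N := mul_le_mul_of_nonneg_right he (Nat.cast_nonneg N)
  have e2 : C * (goodCount (1 / 20) y : ℝ) ≤ C' * goodCount (1 / 20) y := mul_le_mul_of_nonneg_right hC hg0
  linarith

/-- The finite-range split implies the finite-range unsplit residual (positive combination at the level `eUp`):
`T′♭(κ_T, C_T) ∧ E′♭(κ_E, C_E, D_E) ⟹ FRG♭(eUp + κ_E κ_T/(κ_T + D_E⁺ + κ_E), ·)`. [folklore] -/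
theorem schurRangeGap_of_split {η₁ : ℝ} {w ω : ℝ → ℝ} {A eUp κT CT κE CE DE : ℝ} (h01 : (1 : ℝ) / 20 ≤ η₁)
    (hκT : 0 < κT) (hT : SchurTopologicalPricing (1 / 20) η₁ w ω A eUp κT CT)
    (hκE : 0 < κE) (hE : SchurElasticPricing (1 / 20) η₁ w ω A eUp κE CE DE) :
    SchurRangeGap w ω A (eUp + κE * κT / (κT + max DE 0 + κE))
      ((κT * |CE| + max DE 0 * |CT| + κE * |CT| + κE * κT) / (κT + max DE 0 + κE)) := by
  intro N y hy hsep
  set D := max DE 0 with hDdef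
  have hD0 : 0 ≤ D := le_max_right _ _
  have hDE : DE ≤ D := le_max_left _ _
  set S := κT + D + κE with hSdef
  have hS : 0 < S := by positivity
  set M := κT * |CE| + D * |CT| + κE * |CT| + κE * κT with hMdef
  have h1 := hE N y hy hsep
  have h2 := hT N y hy hsep
  set X := interactionEnergy (effPot w ω A) y - A * N - eUp * N with hX
  set g : ℝ := (goodCount (1 / 20) y : ℝ) with hg
  set l : ℝ := (goodCount η₁ y : ℝ) with hl
  have hg0 : 0 ≤ g := Nat.cast_nonneg _
  have hgl : g ≤ l := by rw [hg, hl]; exact_mod_cast goodCount_mono h01 y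
  have hlN : l ≤ N := by rw [hl]; exact_mod_cast goodCount_le η₁ y
  have hCE : CE * g ≤ |CE| * g := mul_le_mul_of_nonneg_right (le_abs_self CE) hg0
  have hCT : CT * g ≤ |CT| * g := mul_le_mul_of_nonneg_right (le_abs_self CT) hg0
  have hDb : DE * ((N : ℝ) - l) ≤ D * ((N : ℝ) - l) := mul_le_mul_of_nonneg_right hDE (by linarith)
  have hE' : κE * (l - g) ≤ X + |CE| * g + D * ((N : ℝ) - l) := by linarith
  have hT' : κT * ((N : ℝ) - l) ≤ X + |CT| * g := by linarith
  have e1 := mul_le_mul_of_nonneg_left hE' hκT.le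
  have e2 := mul_le_mul_of_nonneg_left hT' hD0
  have e3 := mul_le_mul_of_nonneg_left hT' hκE.le
  have hmain : κE * κT * N - M * g ≤ S * X := by
    rw [hMdef, hSdef]
    nlinarith [e1, e2, e3, hg0, hgl, hlN, mul_nonneg hκE.le hκT.le]
  have hdiv : κE * κT / S * N - M / S * g ≤ X := by
    calc κE * κT / S * N - M / S * g = (κE * κT * N - M * g) / S := by field_simp
      _ ≤ S * X / S := div_le_div_of_nonneg_right hmain hS.le
      _ = X := by field_simp
  have : (eUp + κE * κT / S) * N - M / S * g = eUp * N + (κE * κT / S * N - M / S * g) := by ring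
  rw [this, hX] at *
  linarith

-- landing note (hand-2 g12): lens-5 g34 v4 e5cfb03e (490 l) PRE-SPLIT for the 400-line rule at the §3/§4 boundary; §4–§6 continue,
-- byte-identical and in the same namespace, in `FrustratedLawDichotomySchurCutB`.

end Summit.AtomisticToContinuum.Crystallization.Theorems.FrustratedLawDichotomySchurCut

end
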